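import Literature.AlgebraicGeometry.PlaneCurves.HessePencilCharacteristicThree
import HarnessLib

/-!
# Remark 2.1: the web cubic `xy(ax + by + cz) + dz³` is singular when `abc = 0` in characteristic `3` (Artebani–Dolgachev)

Topic `Literature/AlgebraicGeometry/PlaneCurves`, namespace `Literature.AlgebraicGeometry.PlaneCurves`.
Lane `lit-hodgefound`, seat `lit-hodgefound-p37`, row g21-#10; companion of
`HessePencilCharacteristicThreeWebForm` (g21-#9: for `abc ≠ 0` the web cubic is carried to
`(d/c³)·E_t`).  Everything here is PROVED; no definition, no named fact.

Source — M. Artebani, I. Dolgachev, *The Hesse pencil of plane cubic curves*, Enseign. Math. (2) 55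
(2009), §2, Remark 2.1 [`paper:arxiv-math_0611590` p0005 L60], VERBATIM: "We find equation (4)
[`F(x, y, z) = xy(ax + by + cz) + dz³ = 0`] and check that it defines a nonsingular curve only if
`abc ≠ 0`."  (For `3 ≠ 0` the case `c = 0`, `ab ≠ 0` is NONSINGULAR — proof of Lemma 1: "Suppose
`c = 0`, then `ab ≠ 0` since otherwise the curve would be singular […] the equation takes the form
`x³ + y³ + dz³ = 0`"; the statement is special to characteristic `3`.)

## What is here

* §1 (any field) `web_eval`, `web_eval_pderiv` (`F(p)` and `∇F(p)` in coordinates).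
* §2 (any field) `web_singular_of_a_eq_zero` (`a = 0`: `(1, 0, 0)` is a singular point),
  `web_singular_of_b_eq_zero` (`b = 0`: `(0, 1, 0)`), `web_singular_of_c_d_eq_zero` (`c = d = 0`:
  `(0, 0, 1)`).
* §3 (`3 = 0`, `K = K̄`) `web_singular_of_c_eq_zero_of_three_eq_zero` (`c = 0`, `abd ≠ 0`: the point
  `(b, a, z₀)` with `z₀³ = a²b²/d` — here `∂F/∂x = 3a²b`, `∂F/∂y = 3ab²`, `∂F/∂z = 3dz₀²` vanish
  BECAUSE `3 = 0`) and **`web_singular_of_three_eq_zero`**: `abc = 0 ⇒` the web cubic has a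
  singular point — "(4) defines a nonsingular curve only if `abc ≠ 0`".

## References
* [ArtebaniDolgachev2009] M. Artebani, I. Dolgachev, *The Hesse pencil of plane cubic curves*,
  Enseign. Math. (2) 55 (2009) 235–273, §2, Remark 2.1; proof of Lemma 1, eq. (4).
-/

set_option autoImplicit false

open MvPolynomial Matrix

namespace Literature.AlgebraicGeometry.PlaneCurves

universe u

/-- The web cubic `F = xy(ax + by + cz) + dz³` of Lemma 1, eq. (4) (local notation, no definition). -/
local notation3 "𝐅[" a ", " b ", " c ", " d "]" =>
  (X 0 * X 1 * (C a * X 0 + C b * X 1 + C c * X 2) + C d * X 2 ^ 3 : MvPolynomial (Fin 3) _)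

section CharThreeWebSingular

variable {K : Type u} [Field K]

/-! ## §1 The web cubic and its gradient in coordinates -/

/-- The partial derivatives of the web cubic (any field). [folklore] -/
private theorem pderiv_web (a b c d : K) :
    (pderiv 0 𝐅[a, b, c, d] = 2 * C a * X 0 * X 1 + C b * X 1 ^ 2 + C c * X 1 * X 2) ∧
    (pderiv 1 𝐅[a, b, c, d] = C a * X 0 ^ 2 + 2 * C b * X 0 * X 1 + C c * X 0 * X 2) ∧
    (pderiv 2 𝐅[a, b, c, d] = C c * X 0 * X 1 + 3 * C d * X 2 ^ 2) := by
  refine ⟨?_, ?_, ?_⟩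
  · simp only [map_add, Derivation.leibniz, Derivation.leibniz_pow, pderiv_C, pderiv_X]
    simp
    ring
  · simp only [map_add, Derivation.leibniz, Derivation.leibniz_pow, pderiv_C, pderiv_X]
    simp
    ring
  · simp only [map_add, Derivation.leibniz, Derivation.leibniz_pow, pderiv_C, pderiv_X]
    simp
    ring

/-- `F(p) = a p₀²p₁ + b p₀p₁² + c p₀p₁p₂ + d p₂³`. [cite: ArtebaniDolgachev2009, §2, Lemma 1, eq. (4)] -/
theorem web_eval (a b c d : K) (p : Fin 3 → K) :
    eval p 𝐅[a, b, c, d] = a * p 0 ^ 2 * p 1 + b * p 0 * p 1 ^ 2 + c * p 0 * p 1 * p 2 + d * p 2 ^ 3 := by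
  simp; ring

/-- `∇F(p) = (2a p₀p₁ + b p₁² + c p₁p₂, a p₀² + 2b p₀p₁ + c p₀p₂, c p₀p₁ + 3d p₂²)` (any field).
[cite: ArtebaniDolgachev2009, §2, Lemma 1, eq. (4)] -/
theorem web_eval_pderiv (a b c d : K) (p : Fin 3 → K) :
    (fun i => eval p (pderiv i 𝐅[a, b, c, d])) =
      ![2 * a * p 0 * p 1 + b * p 1 ^ 2 + c * p 1 * p 2,
        a * p 0 ^ 2 + 2 * b * p 0 * p 1 + c * p 0 * p 2,
        c * p 0 * p 1 + 3 * d * p 2 ^ 2] := by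
  obtain ⟨d0, d1, d2⟩ := pderiv_web a b c d
  funext i
  fin_cases i
  · show eval p (pderiv 0 𝐅[a, b, c, d]) = _
    rw [d0]; simp [map_ofNat]
  · show eval p (pderiv 1 𝐅[a, b, c, d]) = _
    rw [d1]; simp [map_ofNat]
  · show eval p (pderiv 2 𝐅[a, b, c, d]) = _
    rw [d2]; simp [map_ofNat]

/-! ## §2 `a = 0`, `b = 0`, `c = d = 0`: a vertex of the coordinate triangle is singular (any field) -/

/-- **`a = 0`: `(1, 0, 0)` is a singular point of `xy(by + cz) + dz³`** (any field).
[cite: ArtebaniDolgachev2009, §2, Remark 2.1 ("nonsingular curve only if `abc ≠ 0`")] -/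
theorem web_singular_of_a_eq_zero (b c d : K) :
    eval ![(1 : K), 0, 0] 𝐅[(0 : K), b, c, d] = 0 ∧
      (fun i => eval ![(1 : K), 0, 0] (pderiv i 𝐅[(0 : K), b, c, d])) = 0 := by
  rw [web_eval, web_eval_pderiv]
  constructor
  · simp
  · funext i; fin_cases i <;> simp

/-- **`b = 0`: `(0, 1, 0)` is a singular point of `xy(ax + cz) + dz³`** (any field).
[cite: ArtebaniDolgachev2009, §2, Remark 2.1] -/
theorem web_singular_of_b_eq_zero (a c d : K) :
    eval ![(0 : K), 1, 0] 𝐅[a, (0 : K), c, d] = 0 ∧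
      (fun i => eval ![(0 : K), 1, 0] (pderiv i 𝐅[a, (0 : K), c, d])) = 0 := by
  rw [web_eval, web_eval_pderiv]
  constructor
  · simp
  · funext i; fin_cases i <;> simp

/-- **`c = d = 0`: `(0, 0, 1)` is a singular point of `xy(ax + by)`** (any field).
[cite: ArtebaniDolgachev2009, §2, Remark 2.1; proof of Lemma 1 ("otherwise the curve would be
singular")] -/
theorem web_singular_of_c_d_eq_zero (a b : K) :
    eval ![(0 : K), 0, 1] 𝐅[a, b, (0 : K), (0 : K)] = 0 ∧
      (fun i => eval ![(0 : K), 0, 1] (pderiv i 𝐅[a, b, (0 : K), (0 : K)])) = 0 := by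
  rw [web_eval, web_eval_pderiv]
  constructor
  · simp
  · funext i; fin_cases i <;> simp

/-! ## §3 `c = 0` in characteristic `3` -/

/-- **`c = 0`, `abd ≠ 0`, `3 = 0`, `K = K̄`: `(b, a, z₀)` with `z₀³ = a²b²/d` is a singular point of
`xy(ax + by) + dz³`** — `F(b, a, z₀) = 2a²b² + dz₀³ = 3a²b² = 0`, `∇F = (3a²b, 3ab², 3dz₀²) = 0`.
[cite: ArtebaniDolgachev2009, §2, Remark 2.1 ("nonsingular curve only if `abc ≠ 0`")] -/
theorem web_singular_of_c_eq_zero_of_three_eq_zero [IsAlgClosed K] (h3 : (3 : K) = 0) {a b d : K}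
    (hd : d ≠ 0) :
    ∃ z₀ : K, eval ![b, a, z₀] 𝐅[a, b, (0 : K), d] = 0 ∧
      (fun i => eval ![b, a, z₀] (pderiv i 𝐅[a, b, (0 : K), d])) = 0 := by
  obtain ⟨z₀, hz⟩ := IsAlgClosed.exists_pow_nat_eq (a ^ 2 * b ^ 2 / d) (by norm_num : 0 < 3)
  refine ⟨z₀, ?_, ?_⟩
  · rw [web_eval]
    simp only [Matrix.cons_val_zero, Matrix.cons_val_one, Matrix.cons_val]
    rw [hz, mul_div_cancel₀ _ hd]
    linear_combination (a ^ 2 * b ^ 2) * h3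
  · rw [web_eval_pderiv]
    funext i; fin_cases i
    · simp; linear_combination (a ^ 2 * b) * h3
    · simp; linear_combination (a * b ^ 2) * h3
    · simp; left; left; exact h3

/-- **Artebani–Dolgachev, Remark 2.1: "(4) defines a nonsingular curve only if `abc ≠ 0`"** — for
`3 = 0` over an algebraically closed field: if `abc = 0` then the web cubic `xy(ax + by + cz) + dz³`
has a singular point `p ≠ 0` (`F(p) = 0`, `∇F(p) = 0`). [cite: ArtebaniDolgachev2009, §2,
Remark 2.1] -/
theorem web_singular_of_three_eq_zero [IsAlgClosed K] (h3 : (3 : K) = 0) {a b c d : K}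
    (habc : a * b * c = 0) :
    ∃ p : Fin 3 → K, p ≠ 0 ∧ eval p 𝐅[a, b, c, d] = 0 ∧
      (fun i => eval p (pderiv i 𝐅[a, b, c, d])) = 0 := by
  rcases mul_eq_zero.1 habc with hab | hc
  · rcases mul_eq_zero.1 hab with ha | hb
    · subst ha
      exact ⟨![1, 0, 0], fun h => by simpa using congrFun h 0, web_singular_of_a_eq_zero b c d⟩
    · subst hb
      exact ⟨![0, 1, 0], fun h => by simpa using congrFun h 1, web_singular_of_b_eq_zero a c d⟩
  · subst hc
    by_cases hb : b = 0
    · subst hb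
      exact ⟨![0, 1, 0], fun h => by simpa using congrFun h 1, web_singular_of_b_eq_zero a 0 d⟩
    by_cases hd : d = 0
    · subst hd
      exact ⟨![0, 0, 1], fun h => by simpa using congrFun h 2, web_singular_of_c_d_eq_zero a b⟩
    · obtain ⟨z₀, h1, h2⟩ := web_singular_of_c_eq_zero_of_three_eq_zero h3 (a := a) (b := b) hd
      exact ⟨![b, a, z₀], fun h => hb (by simpa using congrFun h 0), h1, h2⟩

end CharThreeWebSingular

end Literature.AlgebraicGeometry.PlaneCurves
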